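import Summits.QuantumFields.YangMills.Theorems.BalabanUVNodesN15CurvedGluingCubeDefectGluing
import Summits.QuantumFields.YangMills.Theorems.BalabanUVNodesN15TwoSpacingGluingEntries
import HarnessLib

/-!
# THE GLUING STEP AT TWO LATTICE SPACINGS — THE GRADIENT ENTRIES OF A GLUED PROPAGATOR WITH DEFECTS, GENERIC: `D∘𝒢 = (D∘G₀)(1 − R)⁻¹` read through the partition (lattice Leibniz) and
# its two-spacing η-defect — the skeleton of entries 1–2 of (3.42) for dag-n15-w3's glued families (dag-n15-c g16, FILE 136; N15 = NE2, s1 «background-layer OPERATOR ingredient»)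

Cell `pub-ymgap`, seat `pub-ymgap-dag-n15-c` (R134 (a); HUMAN RULING D-0062), generation 16.  `bears_on: R4∕N15 · K3⁸ SpineGivenEndpointR13SepCoPHV (stmt-QuantumFields-27366)`.
Filed `--kind proof --supports stmt-QuantumFields-27366 --as helper` — COUNT-NEUTRAL.  Theorems only; 0 `def`, 0 `sorry`.  Imports BY NAME dag-n15-w3 file 32∕63
`…CurvedGluingCubeDefectGluing` (`hasMaj_remainderD`, `hasMaj_idef_remainderD`; through it FILES 43∕44∕45 `glueInv`, `hasMaj_glueInv`, `hasMaj_idef_glueInv`, `parametrix`, `remainder`,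
`parametrix_cut`) and dag-n15-c FILE 47 `…TwoSpacingGluingEntries` (`hasMaj_comp_parametrix`, `hasMaj_idef_comp_parametrix`: the left-dressed parametrix through lattice Leibniz).
Nothing in the tree is modified.

WHY.  FILES 132∕135 (the live-background `NE2PlusOperator` family) display the two GRADIENT entries of (3.42) (`∇_UG`, `G∇*_U`): dag-n15-w3's capstones 52∕53 conclude entry 0 of the glued
operator `𝒢 = G₀(1 − R)⁻¹` only.  A derivative-type operator `D` with a lattice Leibniz rule through the partition (`D∘M_{h_□} = M_{h^s_□}∘D + M_{dh_□}` — FILE 47 `fgrad_comp_mulOp` ∕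
`bgrad_comp_mulOp`) passes to the glued operator WITHOUT any new resummation: `D∘𝒢 = (D∘G₀)∘(1 − R)⁻¹` (`glueInv G₀ R = G₀ ∘ neumannR R`), `D∘G₀ = Σ_□[M_{h^s_□}(D∘G_□)M_{h_□} + M_{dh_□}G_□M_{h_□}]`,
so the per-cube rows of `G_□` and `D∘G_□` (dag-n15-w3 `hasMaj_fgrad∕bgrad_smoothCutDressed_loc₂`) and their η-defects (`hasMaj_idef_jet_smoothCutDressed_loc₂`) are the ONLY new inputs of the
gradient entries.  This file is that generic skeleton — 52∕53's gluing theorems `hasMaj_glued_of_cutRows_defect` ∕ `hasMaj_idef_glued_of_cutRows_defect` with `D∘` in front.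

WHAT.  `comp_glueInv` (`D∘𝒢 = glueInv (D∘G₀) R`); ★★ `hasMaj_comp_glued_of_cutRows_defect` — one grid: cut rows `M_{χ_□}G_□ ≤ 1_S1_Sβe^{−δd}`, gradient rows `D(M_{χ_□}G_□) ≤ 1_S1_Sβ₁e^{−δd}`,
Leibniz letters `|h^s| ≤ c_s`, `|dh| ≤ c_d`, remainder rows (`θ₀`) and defect rows (`ε`), overlap `N_ov`, `N_ov(θ₀+ε)c_r < 1` ⟹
`D∘𝒢 ≤ N_ov(c_sβ₁ + c_dβ)(1 − N_ov(θ₀+ε)c_r)⁻¹c_r·e^{−(δ−σ)d}`; ★★★ `hasMaj_idef_comp_glued_of_cutRows_defect` — two grids along `π`: the same data on both grids plus the η-defects of the cut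
rows (`m₀`), of the gradient rows (`m₁`), of the remainder rows (`r`), of the defect rows (`r_E`) and the partition fits (`o`, `o_s`, `o_d`) ⟹ `𝔇_π(D′∘𝒢′, D∘𝒢) ≤ […]·e^{−(δ−2σ)d}` with the explicit
constant of FILE 44 `hasMaj_idef_glueInv`.

HONEST FRAMING ∕ LIMITS.  Generic block-majorant bookkeeping (abstract lattice `X`, carrier `g`, operators `D`, cubes `G_□`); proves NO estimate of any concrete propagator — the per-cube gradient
rows and their defects are HYPOTHESES (their instantiation for the live dressed cubes at the cover is the located next step); (2.91)–(2.93), (2.133)–(2.136) of [Balaban1984PropagatorsII] and Thm 3.14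
of [Balaban1985BackgroundPropagators] are cited as SHAPES ∕ MECHANISM; nothing of [B5]∕[B6]∕[B9] asserted.  NE2⁺ NOT PRINTED, NOT proved; N15 NOT discharged; K3⁸ OPEN, skeleton v6 untouched (0∕2);
counts of record UNMOVED (typed 28∕28 · discharged 5∕27 · A 5∕28); one finite 𝕋⁴ at fixed ε — NOT infinite volume, NOT OS on ℝ⁴, NOT a mass gap, NOT Clay; R4 closes the conditional finite-𝕋⁴ rung
`BalabanLadder.UV` only.  Restate-immune (no Theses import).
-/

noncomputable section

open scoped BigOperators

namespace Summit.QuantumFields.YangMills.BalabanUVNodes.N15.Gluing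

open Literature.MathematicalPhysics.QuantumFieldTheory.Balaban1983to89
open Literature.MathematicalPhysics.QuantumFieldTheory.Balaban1983to89.B11SectG (BlockNorm HasMaj RowSum)
open Literature.MathematicalPhysics.QuantumFieldTheory.Balaban1983to89.B6RandomWalk (Triangle254)
open Literature.MathematicalPhysics.QuantumFieldTheory.Balaban1983to89.B6Prop26Gluing (mulOp ind ind_nonneg)
open Literature.MathematicalPhysics.QuantumFieldTheory.Balaban1983to89.T4EtaRateDefect (idef)
open Literature.MathematicalPhysics.QuantumFieldTheory.Balaban1983to89.T4EtaRateCoeffDefect (pull)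
open Summit.QuantumFields.YangMills.BalabanUVNodes.N15.CurvedSpecies (hasMaj_remainderD hasMaj_idef_remainderD)

variable {X X' : Type} [Fintype X] [Fintype X'] [DecidableEq X] [DecidableEq X'] {ι : Type} [Fintype ι] {g : B6.Geometry} (blk : X → g.Site) (π : X' → X)
  (S : ι → Set g.Site) {σ cr : ℝ}

/-- `D∘𝒢 = glueInv (D∘G₀) R`: a left factor passes into the parametrix slot of the glued inverse (`𝒢 = G₀(1 − R)⁻¹`). [cite: Balaban1984PropagatorsII, (2.91) p.239 (shape)] -/
theorem comp_glueInv (D G₀ R : (X → ℝ) →ₗ[ℝ] (X → ℝ)) : D ∘ₗ glueInv G₀ R = glueInv (D ∘ₗ G₀) R := by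
  rw [glueInv_def, glueInv_def, LinearMap.comp_assoc]

/-- ★★ **THE GRADIENT ENTRY OF A GLUED PROPAGATOR WITH DEFECTS, ONE GRID**: for a derivative-type `D` with the lattice Leibniz rule through the partition (`D∘M_{h_□} = M_{h^s_□}∘D + M_{dh_□}`,
`|h| ≤ 1`, `|h^s| ≤ c_s`, `|dh| ≤ c_d`), cut rows `M_{χ_□}G_□ ≤ 1_S1_Sβe^{−δd}` with their GRADIENT rows `D(M_{χ_□}G_□) ≤ 1_S1_Sβ₁e^{−δd}` (`M_{h_□}M_{χ_□} = M_{h_□}`), remainder rows `θ₀`,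
defect rows `ε`, overlap `N_ov`, `N_ov(θ₀ + ε)c_r < 1`, `2σ ≤ δ`:  `D ∘ glueInv (Σ_□M_hG_□M_h) (R − ΣE_□M_h) ≤ N_ov(c_sβ₁ + c_dβ)(1 − N_ov(θ₀+ε)c_r)⁻¹c_r·e^{−(δ−σ)d}`.
[cite: Balaban1984PropagatorsII, (2.91)–(2.92) p.239, Prop. 2.6 (2.133)–(2.136) p.247 (shapes + mechanism); Balaban1985BackgroundPropagators, (3.42) p.397 (gradient entries: shape)] -/
theorem hasMaj_comp_glued_of_cutRows_defect (htri : Triangle254 g) (hd : ∀ a b : g.Site, 0 ≤ g.dist a b) (hd0 : ∀ y : g.Site, g.dist y y = 0) (hrow : RowSum g σ cr) (hσ : 0 ≤ σ)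
    {Δ D : (X → ℝ) →ₗ[ℝ] (X → ℝ)} {h χ hs dh : ι → X → ℝ} {G E : ι → (X → ℝ) →ₗ[ℝ] (X → ℝ)} {β β₁ cs cd θ₀ ε δ Nov : ℝ} (hβ : 0 ≤ β) (hβ₁ : 0 ≤ β₁) (hcs : 0 ≤ cs) (hcd : 0 ≤ cd)
    (hθ : 0 ≤ θ₀) (hε : 0 ≤ ε) (hNov : 0 ≤ Nov) (hσδ : 2 * σ ≤ δ) (hleib : ∀ i, D ∘ₗ mulOp (h i) = mulOp (hs i) ∘ₗ D + mulOp (dh i))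
    (hcut : ∀ i, mulOp (h i) ∘ₗ mulOp (χ i) = mulOp (h i)) (hh : ∀ i x, |h i x| ≤ 1) (hhs : ∀ i x, |hs i x| ≤ cs) (hdh : ∀ i x, |dh i x| ≤ cd) (hN : ∀ a, ∑ i, ind (S i) a ≤ Nov)
    (hGc : ∀ i, HasMaj (BlockNorm.ofBlocks g blk) (BlockNorm.ofBlocks g blk) (mulOp (χ i) ∘ₗ G i) (fun y y' => ind (S i) y * ind (S i) y' * (β * Real.exp (-(δ * g.dist y y')))))
    (hDGc : ∀ i, HasMaj (BlockNorm.ofBlocks g blk) (BlockNorm.ofBlocks g blk) (D ∘ₗ (mulOp (χ i) ∘ₗ G i)) (fun y y' => ind (S i) y * ind (S i) y' * (β₁ * Real.exp (-(δ * g.dist y y')))))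
    (hK : ∀ i, HasMaj (BlockNorm.ofBlocks g blk) (BlockNorm.ofBlocks g blk) (commOp Δ (h i) ∘ₗ G i) (fun y y' => ind (S i) y' * (θ₀ * Real.exp (-(δ * g.dist y y')))))
    (hE : ∀ i, HasMaj (BlockNorm.ofBlocks g blk) (BlockNorm.ofBlocks g blk) (E i) (fun y y' => ind (S i) y * (ε * Real.exp (-(δ * g.dist y y')))))
    (hq : Nov * (θ₀ + ε) * cr < 1) :
    HasMaj (BlockNorm.ofBlocks g blk) (BlockNorm.ofBlocks g blk) (D ∘ₗ glueInv (parametrix h G) (remainder Δ h G - ∑ i, E i ∘ₗ mulOp (h i)))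
      (fun y y' => Nov * (cs * β₁ + cd * β) * (1 - Nov * (θ₀ + ε) * cr)⁻¹ * cr * Real.exp (-((δ - σ) * g.dist y y'))) := by
  have hP := hasMaj_comp_parametrix blk S hβ hβ₁ hcs hcd hleib hh hhs hdh hN hGc hDGc
  rw [parametrix_cut hcut] at hP
  rw [comp_glueInv]
  exact hasMaj_glueInv blk htri hd hd0 hrow hσ (by positivity) (mul_nonneg hNov (add_nonneg hθ hε)) hσδ hP (hasMaj_remainderD blk S hθ hε hh hN hK hE) hq

/-- ★★★ **… AND ITS TWO-SPACING η-DEFECT** (two grids along `π`): the same data on both grids, the partition fits `|h′ − h∘π| ≤ o`, `|h^s′ − h^s∘π| ≤ o_s`, `|dh′ − dh∘π| ≤ o_d`, and the per-cube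
η-defects of the cut rows (`m₀`), of their gradient rows (`m₁`), of the remainder rows (`r`), of the defect rows (`r_E`) ⟹ `𝔇_π(D′∘𝒢′, D∘𝒢) ≤ [A·((1−θc_r)⁻¹((1−θc_r)⁻¹ r̂ c_r)c_r)c_r + m̂(1−θc_r)⁻¹c_r]·e^{−(δ−2σ)d}`
with `A = N_ov(c_sβ₁ + c_dβ)`, `θ = N_ov(θ₀+ε)`, `r̂ = N_ov(θ₀o + r + (εo + r_E))`, `m̂ = N_ov[(c_sβ₁o + c_sm₁ + o_sβ₁) + (c_dβo + c_dm₀ + o_dβ)]` (FILE 44 `hasMaj_idef_glueInv` on FILE 47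
`hasMaj_idef_comp_parametrix` and dag-n15-w3 `hasMaj_idef_remainderD`). [cite: Balaban1985BackgroundPropagators, Thm 3.14 pp.426–427 (difference template), (3.42) p.397 (gradient entries: shape); Balaban1984PropagatorsII, (2.91)–(2.92) p.239, (2.133)–(2.136) p.247] -/
theorem hasMaj_idef_comp_glued_of_cutRows_defect (htri : Triangle254 g) (hd : ∀ a b : g.Site, 0 ≤ g.dist a b) (hd0 : ∀ y : g.Site, g.dist y y = 0) (hrow : RowSum g σ cr) (hσ : 0 ≤ σ)
    (hcr : 0 ≤ cr) {Δ D : (X → ℝ) →ₗ[ℝ] (X → ℝ)} {Δ' D' : (X' → ℝ) →ₗ[ℝ] (X' → ℝ)} {h χ hs dh : ι → X → ℝ} {h' χ' hs' dh' : ι → X' → ℝ} {G E : ι → (X → ℝ) →ₗ[ℝ] (X → ℝ)}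
    {G' E' : ι → (X' → ℝ) →ₗ[ℝ] (X' → ℝ)} {β β₁ cs cd o os od m₀ m₁ θ₀ ε r rE δ Nov : ℝ} (hβ : 0 ≤ β) (hβ₁ : 0 ≤ β₁) (hcs : 0 ≤ cs) (hcd : 0 ≤ cd) (ho : 0 ≤ o) (hos : 0 ≤ os)
    (hod : 0 ≤ od) (hm₀ : 0 ≤ m₀) (hm₁ : 0 ≤ m₁) (hθ : 0 ≤ θ₀) (hε : 0 ≤ ε) (hr : 0 ≤ r) (hrE : 0 ≤ rE) (hNov : 0 ≤ Nov) (hσδ : 2 * σ ≤ δ)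
    (hleib : ∀ i, D ∘ₗ mulOp (h i) = mulOp (hs i) ∘ₗ D + mulOp (dh i)) (hleib' : ∀ i, D' ∘ₗ mulOp (h' i) = mulOp (hs' i) ∘ₗ D' + mulOp (dh' i))
    (hcut : ∀ i, mulOp (h i) ∘ₗ mulOp (χ i) = mulOp (h i)) (hcut' : ∀ i, mulOp (h' i) ∘ₗ mulOp (χ' i) = mulOp (h' i))
    (hh : ∀ i x, |h i x| ≤ 1) (hh' : ∀ i x', |h' i x'| ≤ 1) (hhs' : ∀ i x', |hs' i x'| ≤ cs) (hdh' : ∀ i x', |dh' i x'| ≤ cd)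
    (hfit : ∀ i x', |h' i x' - h i (π x')| ≤ o) (hfits : ∀ i x', |hs' i x' - hs i (π x')| ≤ os) (hfitd : ∀ i x', |dh' i x' - dh i (π x')| ≤ od) (hN : ∀ b, ∑ i, ind (S i) b ≤ Nov)
    (hGc : ∀ i, HasMaj (BlockNorm.ofBlocks g blk) (BlockNorm.ofBlocks g blk) (mulOp (χ i) ∘ₗ G i) (fun y y' => ind (S i) y * ind (S i) y' * (β * Real.exp (-(δ * g.dist y y')))))
    (hGc' : ∀ i, HasMaj (BlockNorm.ofBlocks g (blk ∘ π)) (BlockNorm.ofBlocks g (blk ∘ π)) (mulOp (χ' i) ∘ₗ G' i) (fun y y' => ind (S i) y * ind (S i) y' * (β * Real.exp (-(δ * g.dist y y')))))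
    (hDGc : ∀ i, HasMaj (BlockNorm.ofBlocks g blk) (BlockNorm.ofBlocks g blk) (D ∘ₗ (mulOp (χ i) ∘ₗ G i)) (fun y y' => ind (S i) y * ind (S i) y' * (β₁ * Real.exp (-(δ * g.dist y y')))))
    (hDGc' : ∀ i, HasMaj (BlockNorm.ofBlocks g (blk ∘ π)) (BlockNorm.ofBlocks g (blk ∘ π)) (D' ∘ₗ (mulOp (χ' i) ∘ₗ G' i)) (fun y y' => ind (S i) y * ind (S i) y' * (β₁ * Real.exp (-(δ * g.dist y y')))))
    (hIGc : ∀ i, HasMaj (BlockNorm.ofBlocks g blk) (BlockNorm.ofBlocks g (blk ∘ π)) (idef (pull π) (pull π) (mulOp (χ' i) ∘ₗ G' i) (mulOp (χ i) ∘ₗ G i))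
      (fun y y' => ind (S i) y * ind (S i) y' * (m₀ * Real.exp (-(δ * g.dist y y')))))
    (hIDGc : ∀ i, HasMaj (BlockNorm.ofBlocks g blk) (BlockNorm.ofBlocks g (blk ∘ π)) (idef (pull π) (pull π) (D' ∘ₗ (mulOp (χ' i) ∘ₗ G' i)) (D ∘ₗ (mulOp (χ i) ∘ₗ G i)))
      (fun y y' => ind (S i) y * ind (S i) y' * (m₁ * Real.exp (-(δ * g.dist y y')))))
    (hK : ∀ i, HasMaj (BlockNorm.ofBlocks g blk) (BlockNorm.ofBlocks g blk) (commOp Δ (h i) ∘ₗ G i) (fun y y' => ind (S i) y' * (θ₀ * Real.exp (-(δ * g.dist y y')))))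
    (hK' : ∀ i, HasMaj (BlockNorm.ofBlocks g (blk ∘ π)) (BlockNorm.ofBlocks g (blk ∘ π)) (commOp Δ' (h' i) ∘ₗ G' i) (fun y y' => ind (S i) y' * (θ₀ * Real.exp (-(δ * g.dist y y')))))
    (hDK : ∀ i, HasMaj (BlockNorm.ofBlocks g blk) (BlockNorm.ofBlocks g (blk ∘ π)) (idef (pull π) (pull π) (commOp Δ' (h' i) ∘ₗ G' i) (commOp Δ (h i) ∘ₗ G i))
      (fun y y' => ind (S i) y' * (r * Real.exp (-(δ * g.dist y y')))))
    (hE : ∀ i, HasMaj (BlockNorm.ofBlocks g blk) (BlockNorm.ofBlocks g blk) (E i) (fun y y' => ind (S i) y * (ε * Real.exp (-(δ * g.dist y y')))))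
    (hE' : ∀ i, HasMaj (BlockNorm.ofBlocks g (blk ∘ π)) (BlockNorm.ofBlocks g (blk ∘ π)) (E' i) (fun y y' => ind (S i) y * (ε * Real.exp (-(δ * g.dist y y')))))
    (hDE : ∀ i, HasMaj (BlockNorm.ofBlocks g blk) (BlockNorm.ofBlocks g (blk ∘ π)) (idef (pull π) (pull π) (E' i) (E i)) (fun y y' => ind (S i) y * (rE * Real.exp (-(δ * g.dist y y')))))
    (hq : Nov * (θ₀ + ε) * cr < 1) :
    HasMaj (BlockNorm.ofBlocks g blk) (BlockNorm.ofBlocks g (blk ∘ π))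
      (idef (pull π) (pull π) (D' ∘ₗ glueInv (parametrix h' G') (remainder Δ' h' G' - ∑ i, E' i ∘ₗ mulOp (h' i)))
        (D ∘ₗ glueInv (parametrix h G) (remainder Δ h G - ∑ i, E i ∘ₗ mulOp (h i))))
      (fun y y' => (Nov * (cs * β₁ + cd * β) * ((1 - Nov * (θ₀ + ε) * cr)⁻¹ * ((1 - Nov * (θ₀ + ε) * cr)⁻¹ * (Nov * (θ₀ * o + r + (ε * o + rE))) * cr) * cr) * cr +
        Nov * ((cs * β₁ * o + cs * m₁ * 1 + os * β₁ * 1) + (cd * β * o + cd * m₀ * 1 + od * β * 1)) * (1 - Nov * (θ₀ + ε) * cr)⁻¹ * cr) * Real.exp (-((δ - 2 * σ) * g.dist y y'))) := by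
  have hP' := hasMaj_comp_parametrix (blk ∘ π) S hβ hβ₁ hcs hcd hleib' hh' hhs' hdh' hN hGc' hDGc'
  have hIP := hasMaj_idef_comp_parametrix blk π S hβ hβ₁ hcs hcd ho hos hod hm₀ hm₁ hleib hleib' hh hhs' hdh' hfit hfits hfitd hN hGc hGc' hDGc hDGc' hIGc hIDGc
  rw [parametrix_cut hcut'] at hP'
  rw [parametrix_cut hcut, parametrix_cut hcut'] at hIP
  rw [comp_glueInv, comp_glueInv]
  exact hasMaj_idef_glueInv blk π htri hd hd0 hrow hσ hcr (by positivity) (mul_nonneg hNov (add_nonneg hθ hε)) (by positivity) (by positivity) hσδ hP'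
    (hasMaj_remainderD blk S hθ hε hh hN hK hE) (hasMaj_remainderD (blk ∘ π) S hθ hε hh' hN hK' hE') hIP
    (hasMaj_idef_remainderD blk π S hθ hr hε hrE ho hh hfit hN hK' hDK hE' hDE) hq

end Summit.QuantumFields.YangMills.BalabanUVNodes.N15.Gluing

end
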